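import Summits.Schanuel.Schanuel.Theses.TateNomes
import Literature.Barriers.Schanuel.NesterenkoModularScopeConjectureProofs
import Literature.NumberTheory.Transcendental.PhilipponCriterionHolds
import Literature.NumberTheory.Transcendental.OneMotiveToric

/-!
# Strategy-census sketches for the crux `TateLocusGPCOne` (stmt-Schanuel-17406, route `TateNomes`)

Crux-strategist seat `cstrat-stmt-Schanuel-17406-b1` (planner; nothing here is a Theorems
proposal).  Kernel-checked content:

* `tateLocusGPCOne_iff` — the crux through the helpers `twoPiI`, `nesterenkoFive` (`Iff.rfl`).
* STRENGTHEN: `PhilipponSequenceFive` (S⁺ = the input the only known engine — Philippon's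
  criterion, PROVED in tree as `Philippon1986_criterion_holds` — would consume, exponent `a = 5`
  at the six-tuple `(2πi, τ, q, P, Q, R)`) and `tateLocusGPCOne_of_philipponSequenceFive : S⁺ → crux`.
* DECOMPOSITION: the best typed split `NesterenkoTau` (= Nesterenko's Conjecture 1.11, corrected,
  in route coordinates) `∧` `PiRigidity` (if `2πi` is algebraic over `ℚ(τ, q, P, Q, R)` then those
  five are free) with the glue `tateLocusGPCOne_of_subs` PROVED (insert-dichotomy on `2πi`).
* The weaker rung `FourRung` (S⁻, `4 ≤ trdeg`) and `fourRung_of_crux`.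
-/

noncomputable section

open Complex IntermediateField Filter
open Literature.Barriers.Schanuel (trdeg_adjoin_union_eq_of_isAlgebraic_adjoin)

set_option linter.dupNamespace false

namespace Summit.Schanuel.Schanuel.Cruxes.TateLocusGPCOne.Strategist

/-- `2πi`, spelled as in the route file. -/
def twoPiI : ℂ := 2 * (Real.pi : ℂ) * Complex.I

/-- The five Nesterenko coordinates `τ, q = e^{2πiτ}, P(q), Q(q), R(q)` (q-series spelled as in the
route file). -/
def nesterenkoFive (τ : ℂ) : Set ℂ :=
  {τ, Complex.exp (2 * Real.pi * Complex.I * τ),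
    1 - 24 * ∑' l : ℕ, (ArithmeticFunction.sigma 1 (l + 1) : ℂ) *
      Complex.exp (2 * Real.pi * Complex.I * τ) ^ (l + 1),
    1 + 240 * ∑' l : ℕ, (ArithmeticFunction.sigma 3 (l + 1) : ℂ) *
      Complex.exp (2 * Real.pi * Complex.I * τ) ^ (l + 1),
    1 - 504 * ∑' l : ℕ, (ArithmeticFunction.sigma 5 (l + 1) : ℂ) *
      Complex.exp (2 * Real.pi * Complex.I * τ) ^ (l + 1)}

/-- "`τ` is not a root of a monic rational quadratic" (non-CM clause of the crux). -/
def NonQuadratic (τ : ℂ) : Prop := ∀ b c : ℚ, τ ^ 2 + (b : ℂ) * τ + (c : ℂ) ≠ 0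

/-- The crux through the helpers (definitional). -/
theorem tateLocusGPCOne_iff :
    Summit.Schanuel.Schanuel.Theses.TateNomes.TateLocusGPCOne ↔
      ∀ τ : ℂ, 0 < τ.im → NonQuadratic τ →
        (5 : Cardinal) ≤ Algebra.trdeg ℚ ↥(adjoin ℚ (insert twoPiI (nesterenkoFive τ))) :=
  Iff.rfl

/-! ## Decomposition: `NesterenkoTau ∧ PiRigidity → crux` (glue proved) -/

/-- Sub₁ — Nesterenko's Conjecture 1.11 (corrected form, LNM 1752 Ch. 3; tree
`Literature.Barriers.Schanuel.NesterenkoConjecture_1_11_corrected`) in route coordinates: for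
`Im τ > 0`, `τ` non-quadratic, `4 ≤ trdeg_ℚ ℚ(τ, q, P(q), Q(q), R(q))`. OPEN. -/
def NesterenkoTau : Prop :=
  ∀ τ : ℂ, 0 < τ.im → NonQuadratic τ →
    (4 : Cardinal) ≤ Algebra.trdeg ℚ ↥(adjoin ℚ (nesterenkoFive τ))

/-- Sub₂ — `π`-rigidity: if `2πi` is algebraic over the Nesterenko field `ℚ(τ, q, P, Q, R)` (e.g.
`τ ∈ i·ℚ̄·π^{±1}`: `τ = i/2π`, the `(e, π)` cell), then that field is free (`trdeg = 5`). OPEN; it is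
the crux restricted to the regime `2πi ∈ ℚ(τ,q,P,Q,R)^{alg}` and contains `e ⊥ π`. -/
def PiRigidity : Prop :=
  ∀ τ : ℂ, 0 < τ.im → NonQuadratic τ → IsAlgebraic ↥(adjoin ℚ (nesterenkoFive τ)) twoPiI →
    (5 : Cardinal) ≤ Algebra.trdeg ℚ ↥(adjoin ℚ (nesterenkoFive τ))

/-- Adjoining an element transcendental over `K(S)` raises `trdeg_K` by at least one (tower law
`trdeg_add_eq` along `K ⊆ K(S) ⊆ K(S)(x) = K(S ∪ {x})` and `1 ≤ trdeg_{K(S)} K(S)(x)`). [folklore] -/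
theorem trdeg_adjoin_add_one_le_of_transcendental {K E : Type} [Field K] [Field E] [Algebra K E]
    (S : Set E) {x : E} (hx : Transcendental ↥(adjoin K S) x) :
    Algebra.trdeg K ↥(adjoin K S) + 1 ≤ Algebra.trdeg K ↥(adjoin K (insert x S)) := by
  haveI : FaithfulSMul (adjoin K S) (adjoin (adjoin K S) ({x} : Set E)) :=
    (faithfulSMul_iff_algebraMap_injective (adjoin K S) (adjoin (adjoin K S) ({x} : Set E))).mpr
      (algebraMap (adjoin K S) (adjoin (adjoin K S) ({x} : Set E))).injective
  have htower := trdeg_add_eq K (adjoin K S) (A := adjoin (adjoin K S) ({x} : Set E))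
  have heq : Algebra.trdeg K (adjoin (adjoin K S) ({x} : Set E)) =
      Algebra.trdeg K (adjoin K (S ∪ {x})) := by
    rw [← (equivOfEq (adjoin_adjoin_left K S {x})).trdeg_eq]
    rfl
  have h1 : (1 : Cardinal) ≤ Algebra.trdeg (adjoin K S) (adjoin (adjoin K S) ({x} : Set E)) := by
    let t : adjoin (adjoin K S) ({x} : Set E) := ⟨x, mem_adjoin_simple_self _ x⟩
    have ht : Transcendental (adjoin K S) t := fun halg =>
      hx (halg.algHom (adjoin (adjoin K S) ({x} : Set E)).val)
    have hind : AlgebraicIndependent (adjoin K S) ![t] :=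
      algebraicIndependent_iff_transcendental.mpr ht
    simpa using hind.cardinalMk_le_trdeg
  have hun : S ∪ {x} = insert x S := Set.union_singleton
  calc Algebra.trdeg K ↥(adjoin K S) + 1
      ≤ Algebra.trdeg K ↥(adjoin K S) +
          Algebra.trdeg (adjoin K S) (adjoin (adjoin K S) ({x} : Set E)) :=
        add_le_add le_rfl h1
    _ = Algebra.trdeg K (adjoin K (S ∪ {x})) := by rw [htower, heq]
    _ = Algebra.trdeg K ↥(adjoin K (insert x S)) := by rw [hun]

/-- **Glue of the split** (PROVED): `NesterenkoTau → PiRigidity → TateLocusGPCOne`, by the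
dichotomy "`2πi` algebraic / transcendental over `ℚ(τ, q, P, Q, R)`". -/
theorem tateLocusGPCOne_of_subs (hA : NesterenkoTau) (hB : PiRigidity) :
    Summit.Schanuel.Schanuel.Theses.TateNomes.TateLocusGPCOne := by
  rw [tateLocusGPCOne_iff]
  intro τ hτ hnq
  by_cases halg : IsAlgebraic ↥(adjoin ℚ (nesterenkoFive τ)) twoPiI
  · have h := trdeg_adjoin_union_eq_of_isAlgebraic_adjoin (K := ℚ) (nesterenkoFive τ) {twoPiI}
      (fun w hw => by rwa [Set.mem_singleton_iff.1 hw])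
    rw [Set.union_singleton] at h
    calc (5 : Cardinal) ≤ Algebra.trdeg ℚ ↥(adjoin ℚ (nesterenkoFive τ)) := hB τ hτ hnq halg
      _ = Algebra.trdeg ℚ ↥(adjoin ℚ (insert twoPiI (nesterenkoFive τ))) := h.symm
  · have h4 := hA τ hτ hnq
    have h5 := trdeg_adjoin_add_one_le_of_transcendental (K := ℚ) (nesterenkoFive τ) halg
    calc (5 : Cardinal) = 4 + 1 := by norm_num
      _ ≤ Algebra.trdeg ℚ ↥(adjoin ℚ (nesterenkoFive τ)) + 1 := add_le_add h4 le_rfl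
      _ ≤ Algebra.trdeg ℚ ↥(adjoin ℚ (insert twoPiI (nesterenkoFive τ))) := h5

/-- Conversely the crux gives Sub₁ (dropping `2πi` costs at most one degree) … -/
theorem nesterenkoTau_of_crux (h : Summit.Schanuel.Schanuel.Theses.TateNomes.TateLocusGPCOne) :
    NesterenkoTau := by
  rw [tateLocusGPCOne_iff] at h
  intro τ hτ hnq
  have h5 := h τ hτ hnq
  have hle := Literature.NumberTheory.Transcendental.trdeg_adjoin_insert_le (nesterenkoFive τ) twoPiI
  have : (5 : Cardinal) ≤ Algebra.trdeg ℚ ↥(adjoin ℚ (nesterenkoFive τ)) + 1 := h5.trans hle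
  -- `5 ≤ t + 1 → 4 ≤ t`: trivial for infinite `t`, arithmetic for finite `t`
  by_cases hinf : Cardinal.aleph0 ≤ Algebra.trdeg ℚ ↥(adjoin ℚ (nesterenkoFive τ))
  · exact le_trans (Cardinal.nat_lt_aleph0 4).le hinf
  · obtain ⟨n, hn⟩ := Cardinal.lt_aleph0.1 (not_le.1 hinf)
    rw [hn] at this ⊢
    have h' : (5 : ℕ) ≤ n + 1 := by exact_mod_cast this
    have h'' : (4 : ℕ) ≤ n := by omega
    exact_mod_cast h''

/-- … and Sub₂ (if `2πi` is algebraic over the five, the six-generated field has the same `trdeg`). -/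
theorem piRigidity_of_crux (h : Summit.Schanuel.Schanuel.Theses.TateNomes.TateLocusGPCOne) :
    PiRigidity := by
  rw [tateLocusGPCOne_iff] at h
  intro τ hτ hnq halg
  have hEq := trdeg_adjoin_union_eq_of_isAlgebraic_adjoin (K := ℚ) (nesterenkoFive τ) {twoPiI}
    (fun w hw => by rwa [Set.mem_singleton_iff.1 hw])
  rw [Set.union_singleton] at hEq
  calc (5 : Cardinal) ≤ Algebra.trdeg ℚ ↥(adjoin ℚ (insert twoPiI (nesterenkoFive τ))) := h τ hτ hnq
    _ = Algebra.trdeg ℚ ↥(adjoin ℚ (nesterenkoFive τ)) := hEq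

/-! ## Strengthen: the Philippon-ready form S⁺ -/

/-- The six-tuple `(2πi, τ, q, P, Q, R)` as a `Fin 6`-vector. -/
def sixTuple (τ : ℂ) : Fin 6 → ℂ :=
  ![twoPiI, τ, Complex.exp (2 * Real.pi * Complex.I * τ),
    1 - 24 * ∑' l : ℕ, (ArithmeticFunction.sigma 1 (l + 1) : ℂ) *
      Complex.exp (2 * Real.pi * Complex.I * τ) ^ (l + 1),
    1 + 240 * ∑' l : ℕ, (ArithmeticFunction.sigma 3 (l + 1) : ℂ) *
      Complex.exp (2 * Real.pi * Complex.I * τ) ^ (l + 1),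
    1 - 504 * ∑' l : ℕ, (ArithmeticFunction.sigma 5 (l + 1) : ℂ) *
      Complex.exp (2 * Real.pi * Complex.I * τ) ^ (l + 1)]

theorem range_sixTuple (τ : ℂ) : Set.range (sixTuple τ) = insert twoPiI (nesterenkoFive τ) := by
  ext x
  simp only [sixTuple, nesterenkoFive, Set.mem_range, Set.mem_insert_iff, Set.mem_singleton_iff]
  constructor
  · rintro ⟨i, rfl⟩
    fin_cases i <;> simp
  · rintro (rfl | rfl | rfl | rfl | rfl | rfl)
    · exact ⟨0, rfl⟩
    · exact ⟨1, rfl⟩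
    · exact ⟨2, rfl⟩
    · exact ⟨3, rfl⟩
    · exact ⟨4, rfl⟩
    · exact ⟨5, rfl⟩

/-- **S⁺ (Philippon-ready strengthening).** For every Tate-locus `τ` and every `C > 0`, for all
large `N` there are integer polynomials `Q_{N,1..m}` in six variables of degree `≤ N`, height
`≤ e^N`, all `≤ e^{−C N^5}` in absolute value at `(2πi, τ, q, P, Q, R)` and without common zero in
the polydisc of radius `e^{−3CN^5}` — exactly the hypothesis of Philippon's criterion (LNM 1752
Ch. 14 Prop. 3.2, tree `Philippon1986_criterion`) with `a = 5`.  Nesterenko's construction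
(Ch. 3 Lemma 2.2: `deg, log H ≤ γ₀ N log² N`, `|A_N| ≍ e^{−γ N⁴}`) realises the exponent `4⁻`
from the FOUR functions `z, P, Q, R`; the exponent `5` would need two more arithmetic functions. -/
def PhilipponSequenceFive : Prop :=
  ∀ τ : ℂ, 0 < τ.im → NonQuadratic τ → ∀ C : ℝ, 0 < C →
    ∀ᶠ N : ℕ in atTop, ∃ (m : ℕ) (Q : Fin m → MvPolynomial (Fin 6) ℤ), 1 ≤ m ∧
      (∀ j, (Q j).totalDegree ≤ N) ∧
      (∀ j, (Literature.NumberTheory.Transcendental.mvPolyHeight (Q j) : ℝ) ≤ Real.exp N) ∧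
      (∀ j, ‖MvPolynomial.aeval (sixTuple τ) (Q j)‖ ≤ Real.exp (-(C * (N : ℝ) ^ (5 : ℝ)))) ∧
      ∀ z : Fin 6 → ℂ, (∀ i, ‖z i - sixTuple τ i‖ ≤ Real.exp (-(3 * C * (N : ℝ) ^ (5 : ℝ)))) →
        ∃ j, MvPolynomial.aeval z (Q j) ≠ 0

/-- **S⁺ → crux** (PROVED from the tree's `Philippon1986_criterion_holds`). -/
theorem tateLocusGPCOne_of_philipponSequenceFive (h : PhilipponSequenceFive) :
    Summit.Schanuel.Schanuel.Theses.TateNomes.TateLocusGPCOne := by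
  rw [tateLocusGPCOne_iff]
  intro τ hτ hnq
  obtain ⟨C, hC, hcrit⟩ :=
    Literature.NumberTheory.Transcendental.Philippon1986_criterion_holds 6 (sixTuple τ) 5
      (by norm_num)
  have h5 := hcrit (h τ hτ hnq C hC)
  have hfl : ⌊(5 : ℝ)⌋₊ = 5 := by norm_num
  rw [hfl] at h5
  have key : adjoin ℚ (Set.range (sixTuple τ)) = adjoin ℚ (insert twoPiI (nesterenkoFive τ)) := by
    rw [range_sixTuple]
  have ht := (equivOfEq key).trdeg_eq
  calc (5 : Cardinal) = ((5 : ℕ) : Cardinal) := by norm_num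
    _ ≤ Algebra.trdeg ℚ ↥(adjoin ℚ (Set.range (sixTuple τ))) := h5
    _ = Algebra.trdeg ℚ ↥(adjoin ℚ (insert twoPiI (nesterenkoFive τ))) := ht

/-! ## The next rung S⁻ (`4 ≤ trdeg`), for the record -/

/-- S⁻: four algebraically independent numbers among `2πi, τ, q, P, Q, R` (one more than
Nesterenko's theorem gives; implied by the crux and by `NesterenkoTau`). OPEN in every regime. -/
def FourRung : Prop :=
  ∀ τ : ℂ, 0 < τ.im → NonQuadratic τ →
    (4 : Cardinal) ≤ Algebra.trdeg ℚ ↥(adjoin ℚ (insert twoPiI (nesterenkoFive τ)))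

theorem fourRung_of_nesterenkoTau (hA : NesterenkoTau) : FourRung := by
  intro τ hτ hnq
  have hle : adjoin ℚ (nesterenkoFive τ) ≤ adjoin ℚ (insert twoPiI (nesterenkoFive τ)) :=
    adjoin.mono ℚ _ _ (Set.subset_insert _ _)
  exact (hA τ hτ hnq).trans
    (trdeg_le_of_injective (inclusion hle) (inclusion_injective hle))

theorem fourRung_of_crux (h : Summit.Schanuel.Schanuel.Theses.TateNomes.TateLocusGPCOne) :
    FourRung :=
  fourRung_of_nesterenkoTau (nesterenkoTau_of_crux h)

end Summit.Schanuel.Schanuel.Cruxes.TateLocusGPCOne.Strategist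

end
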